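import Summits.QuantumFields.YangMills.Theorems.EguchiKawaiDirectionLadderWilsonWords
import Summits.QuantumFields.YangMills.Theorems.EguchiKawaiDirectionLadderPlaquetteLoopEquation
import HarnessLib

/-!
# Second variation of an arbitrary Eguchi–Kawai word along the right flow on `SU(N)^d`

HONEST FRAMING. Glue for LINE 8 (`route-QuantumFields-EguchiKawaiDirectionLadder`, barrier-ledger line
onto `Literature.Barriers.QuantumFields.EguchiKawaiBreakdown`), lane «loop equations of the single-site
model»: the calculus layer for the loop (Schwinger–Dyson) equation of a GENERAL reduced contour
(Makeenko (14.44)–(14.50)), extending the four-letter `ExpWordCalculus` of the YMGap venture to the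
word matrices `ekWordMat l` (`l : List (Fin d × Bool)`, w2's `EguchiKawaiDirectionLadderWilsonWordDefs`).

Along the right flow `s ↦ g · e^{sV}` (`g ∈ SU(N)^d`, `V ∈ 𝔲(N)^d`) the letter `(μ, +)` moves as
`g_μ e^{sV_μ}` and the letter `(μ, -)` as `e^{-sV_μ} g_μᴴ`; we record the **jets**
`ekLetterJet n` (`n`-th `s`-derivative of a letter: `g_μ V_μⁿ e^{sV_μ}`, resp. `(-V_μ)ⁿ e^{-sV_μ} g_μᴴ`),
the word `ekWordJet0 l s = ∏ letters(s)` and its first and second derivatives `ekWordJet1`,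
`ekWordJet2` (Leibniz recursion along the list), and prove

* `hasDerivAt_ekLetterJet`, `hasDerivAt_ekWordJet0`, `hasDerivAt_ekWordJet1` — the derivative
  recursions;
* `ekWordMat_flow` — `ekWordMat l (g e^{sV}) = ekWordJet0 l s`;
* `algD_algD_reTr_ekWordMat` — **`D_V D_V Re tr W_l (g) = Re tr (ekWordJet2 l 0)`**: the second
  left-invariant derivative of the trace of ANY word is the real trace of the explicit second jet
  (sum over letters of the `V²`-insertions plus twice the sum over ordered pairs of `V`-insertions).

This is the input of the splitting formula / loop equation for general words (next file) and of
Hessian bounds for general single-site multi-matrix actions. Nothing here concerns the Yang–Mills mass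
gap / the summit Statement `YangMills`.

References: Y. Makeenko, *Methods of Contemporary Gauge Theory* (2023) §12.3–12.4 (loop-space
calculus), §14.3; S. Chatterjee, CMP 366 (2019) 203, §8 (Stein / Schwinger–Dyson derivation).
-/

noncomputable section

open scoped Matrix ComplexConjugate BigOperators Matrix.Norms.Frobenius ContDiff Topology
open Matrix Complex Finset MeasureTheory Filter
open Summit.Ventures.YMGap.LatticeBakryEmery
open Summit.Ventures.YMGap
open Summit.Ventures.YMGap.HessianSharp (hasDerivAt_reTrace reTrCLM conjTranspose_exp_smul_of_skew)
open Literature.Barriers.QuantumFields (EKConfigSU ekHaarSU inclSU)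

namespace Summit.QuantumFields.YangMills.Theorems.EguchiKawaiDirectionLadder

variable {d N : ℕ}

section Jets

-- As in the venture's `ExpWordCalculus`: the analytic facts about `exp` live in a scoped normed
-- structure on matrices which is only reducibly-defeq to the Pi structure used by the definitions.
set_option backward.isDefEq.respectTransparency false

variable (g : PSU (Fin d) N) (V : Cfg (Fin d) N)

/-- The `n`-th jet of a letter along the right flow `s ↦ g e^{sV}`:
`(μ,+) ↦ g_μ V_μⁿ e^{sV_μ}`, `(μ,-) ↦ (-V_μ)ⁿ e^{-sV_μ} g_μᴴ` (`n = 0`: the moving letter itself). -/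
def ekLetterJet (n : ℕ) (a : Fin d × Bool) (s : ℝ) : Matrix (Fin N) (Fin N) ℂ :=
  if a.2 then (g a.1 : Matrix (Fin N) (Fin N) ℂ) * (V a.1 ^ n * NormedSpace.exp (s • V a.1))
  else ((-V a.1) ^ n * NormedSpace.exp (s • (-V a.1))) * (g a.1 : Matrix (Fin N) (Fin N) ℂ)ᴴ

/-- The moving word `W_l(s) = ∏_j letter_j(s)`. -/
def ekWordJet0 (l : List (Fin d × Bool)) (s : ℝ) : Matrix (Fin N) (Fin N) ℂ :=
  (l.map fun a => ekLetterJet g V 0 a s).prod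

/-- The first derivative of the moving word (Leibniz recursion):
`W₁(a :: l) = a'(s) W_l(s) + a(s) W₁(l)(s)`. -/
def ekWordJet1 : List (Fin d × Bool) → ℝ → Matrix (Fin N) (Fin N) ℂ
  | [], _ => 0
  | a :: l, s => ekLetterJet g V 1 a s * ekWordJet0 g V l s + ekLetterJet g V 0 a s * ekWordJet1 l s

/-- The second derivative of the moving word (Leibniz recursion):
`W₂(a :: l) = a'' W_l + a' W₁(l) + (a' W₁(l) + a W₂(l))`. -/
def ekWordJet2 : List (Fin d × Bool) → ℝ → Matrix (Fin N) (Fin N) ℂ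
  | [], _ => 0
  | a :: l, s => ekLetterJet g V 2 a s * ekWordJet0 g V l s + ekLetterJet g V 1 a s * ekWordJet1 g V l s
      + (ekLetterJet g V 1 a s * ekWordJet1 g V l s + ekLetterJet g V 0 a s * ekWordJet2 l s)

/-- The empty moving word is `1`. -/
@[simp] theorem ekWordJet0_nil (s : ℝ) : ekWordJet0 g V [] s = 1 := by simp [ekWordJet0]

/-- The moving word of `a :: l`. -/
@[simp] theorem ekWordJet0_cons (a : Fin d × Bool) (l : List (Fin d × Bool)) (s : ℝ) :
    ekWordJet0 g V (a :: l) s = ekLetterJet g V 0 a s * ekWordJet0 g V l s := by simp [ekWordJet0]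

/-- The first jet of the empty word vanishes. -/
@[simp] theorem ekWordJet1_nil (s : ℝ) : ekWordJet1 g V [] s = 0 := rfl

/-- The first jet of `a :: l` (Leibniz). -/
@[simp] theorem ekWordJet1_cons (a : Fin d × Bool) (l : List (Fin d × Bool)) (s : ℝ) :
    ekWordJet1 g V (a :: l) s =
      ekLetterJet g V 1 a s * ekWordJet0 g V l s + ekLetterJet g V 0 a s * ekWordJet1 g V l s := rfl

/-- The second jet of the empty word vanishes. -/
@[simp] theorem ekWordJet2_nil (s : ℝ) : ekWordJet2 g V [] s = 0 := rfl

/-- The second jet of `a :: l` (Leibniz). -/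
@[simp] theorem ekWordJet2_cons (a : Fin d × Bool) (l : List (Fin d × Bool)) (s : ℝ) :
    ekWordJet2 g V (a :: l) s =
      ekLetterJet g V 2 a s * ekWordJet0 g V l s + ekLetterJet g V 1 a s * ekWordJet1 g V l s
        + (ekLetterJet g V 1 a s * ekWordJet1 g V l s + ekLetterJet g V 0 a s * ekWordJet2 g V l s) := rfl

/-! ### Derivatives along the flow -/

/-- `d/ds letter^{(n)}(s) = letter^{(n+1)}(s)`. -/
theorem hasDerivAt_ekLetterJet (n : ℕ) (a : Fin d × Bool) (s : ℝ) :
    HasDerivAt (fun s => ekLetterJet g V n a s) (ekLetterJet g V (n + 1) a s) s := by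
  unfold ekLetterJet
  by_cases h : a.2 = true
  · simp only [h, if_true]
    have e := ((hasDerivAt_exp_smul_const' (𝕂 := ℝ) (V a.1) s).const_mul (V a.1 ^ n)).const_mul
      (g a.1 : Matrix (Fin N) (Fin N) ℂ)
    convert e using 2 <;> first | rfl | rw [pow_succ, Matrix.mul_assoc]
  · simp only [h, if_false, Bool.false_eq_true]
    have e := ((hasDerivAt_exp_smul_const' (𝕂 := ℝ) (-V a.1) s).const_mul ((-V a.1) ^ n)).mul_const
      (g a.1 : Matrix (Fin N) (Fin N) ℂ)ᴴ
    convert e using 2 <;> first | rfl | rw [pow_succ, Matrix.mul_assoc ((-V a.1) ^ n)]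

/-- `d/ds W_l(s) = W₁(l)(s)`. -/
theorem hasDerivAt_ekWordJet0 (l : List (Fin d × Bool)) (s : ℝ) :
    HasDerivAt (ekWordJet0 g V l) (ekWordJet1 g V l s) s := by
  induction l with
  | nil =>
    simp only [ekWordJet1_nil]
    have : ekWordJet0 g V [] = fun _ => (1 : Matrix (Fin N) (Fin N) ℂ) := funext fun s => ekWordJet0_nil g V s
    rw [this]
    exact hasDerivAt_const _ _
  | cons a l ih =>
    have h := (hasDerivAt_ekLetterJet g V 0 a s).mul ih
    have e : ekWordJet0 g V (a :: l) = fun s => ekLetterJet g V 0 a s * ekWordJet0 g V l s :=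
      funext fun s => ekWordJet0_cons g V a l s
    rw [e, ekWordJet1_cons]
    exact h

/-- `d/ds W₁(l)(s) = W₂(l)(s)`. -/
theorem hasDerivAt_ekWordJet1 (l : List (Fin d × Bool)) (s : ℝ) :
    HasDerivAt (ekWordJet1 g V l) (ekWordJet2 g V l s) s := by
  induction l with
  | nil =>
    simp only [ekWordJet2_nil]
    have : ekWordJet1 g V [] = fun _ => (0 : Matrix (Fin N) (Fin N) ℂ) := funext fun s => rfl
    rw [this]
    exact hasDerivAt_const _ _
  | cons a l ih =>
    have h := ((hasDerivAt_ekLetterJet g V 1 a s).mul (hasDerivAt_ekWordJet0 g V l s)).add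
      ((hasDerivAt_ekLetterJet g V 0 a s).mul ih)
    have e : ekWordJet1 g V (a :: l) =
        fun s => ekLetterJet g V 1 a s * ekWordJet0 g V l s + ekLetterJet g V 0 a s * ekWordJet1 g V l s :=
      funext fun s => rfl
    rw [e, ekWordJet2_cons]
    exact h

/-- **Second derivative of `Re tr W_l(s)` at `s = 0`** is `Re tr W₂(l)(0)`. -/
theorem iteratedDeriv_two_reTr_ekWordJet0 (l : List (Fin d × Bool)) :
    iteratedDeriv 2 (fun s => (ekWordJet0 g V l s).trace.re) 0 = (ekWordJet2 g V l 0).trace.re := by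
  rw [iteratedDeriv_succ, iteratedDeriv_one]
  have h1 : deriv (fun s => (ekWordJet0 g V l s).trace.re) = fun s => (ekWordJet1 g V l s).trace.re :=
    funext fun s => (hasDerivAt_reTrace (hasDerivAt_ekWordJet0 g V l s)).deriv
  rw [h1]
  exact (hasDerivAt_reTrace (hasDerivAt_ekWordJet1 g V l 0)).deriv

/-! ### The flow of the word matrix -/

/-- Along the right flow, each ambient letter is the moving letter (skew-Hermitian `V`). -/
theorem ekLetterMat_flow (hV : ∀ e, (V e)ᴴ = -V e) (a : Fin d × Bool) (s : ℝ) :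
    ekLetterMat (emb g * NormedSpace.exp (s • V)) a = ekLetterJet g V 0 a s := by
  unfold ekLetterMat ekLetterJet
  by_cases h : a.2 = true
  · simp only [h, if_true, emb_mul_exp_apply, pow_zero, Matrix.one_mul]
  · simp only [h, if_false, Bool.false_eq_true, emb_mul_exp_apply, Matrix.conjTranspose_mul,
      conjTranspose_exp_smul_of_skew (hV _), pow_zero, Matrix.one_mul]

/-- **`ekWordMat l (g e^{sV}) = W_l(s)`**. -/
theorem ekWordMat_flow (hV : ∀ e, (V e)ᴴ = -V e) (l : List (Fin d × Bool)) (s : ℝ) :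
    ekWordMat l (emb g * NormedSpace.exp (s • V)) = ekWordJet0 g V l s := by
  induction l with
  | nil => simp
  | cons a l ih => rw [ekWordMat_cons, ekWordJet0_cons, ih, ekLetterMat_flow g V hV]

/-- `Q ↦ Re tr (ekWordMat l Q)` is smooth. -/
theorem contDiff_reTr_ekWordMat (l : List (Fin d × Bool)) :
    ContDiff ℝ ∞ fun Q : Cfg (Fin d) N => (ekWordMat l Q).trace.re :=
  (reTrCLM (n := Fin N)).contDiff.comp (contDiff_ekWordMat l)

/-- **`D_V D_V Re tr W_l (g) = Re tr W₂(l)(0)`** for `g ∈ SU(N)^d`, `V ∈ 𝔲(N)^d`: the second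
left-invariant derivative of the trace of an arbitrary word is the real trace of its second jet. -/
theorem algD_algD_reTr_ekWordMat (hV : ∀ e, (V e)ᴴ = -V e) (l : List (Fin d × Bool)) :
    algD V (algD V (fun Q : Cfg (Fin d) N => (ekWordMat l Q).trace.re)) (emb g) =
      (ekWordJet2 g V l 0).trace.re := by
  rw [← iteratedDeriv_two_emb_mul_exp (contDiff_reTr_ekWordMat l) g V]
  have hflow : (fun s : ℝ => (ekWordMat l (emb g * NormedSpace.exp (s • V))).trace.re) =
      fun s => (ekWordJet0 g V l s).trace.re := funext fun s => by rw [ekWordMat_flow g V hV]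
  rw [hflow, iteratedDeriv_two_reTr_ekWordJet0]

/-! ### The jets at `s = 0` -/

/-- The letter at time `0` is the letter. -/
theorem ekLetterJet_zero_zero (a : Fin d × Bool) : ekLetterJet g V 0 a 0 = ekLetterMat (emb g) a := by
  unfold ekLetterJet ekLetterMat
  by_cases h : a.2 = true
  · simp [h]
  · simp [h]

/-- The word at time `0` is the word. -/
theorem ekWordJet0_zero (l : List (Fin d × Bool)) : ekWordJet0 g V l 0 = ekWordMat l (emb g) := by
  induction l with
  | nil => simp
  | cons a l ih => rw [ekWordJet0_cons, ekWordMat_cons, ih, ekLetterJet_zero_zero]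

/-- The first jet of a letter at `s = 0`: `g_μ V_μ`, resp. `-V_μ g_μᴴ`. -/
theorem ekLetterJet_one_zero (a : Fin d × Bool) :
    ekLetterJet g V 1 a 0 =
      if a.2 then (g a.1 : Matrix (Fin N) (Fin N) ℂ) * V a.1 else -V a.1 * (g a.1 : Matrix (Fin N) (Fin N) ℂ)ᴴ := by
  unfold ekLetterJet
  by_cases h : a.2 = true
  · simp [h]
  · simp [h]

/-- The second jet of a letter at `s = 0`: `g_μ V_μ²`, resp. `V_μ² g_μᴴ`. -/
theorem ekLetterJet_two_zero (a : Fin d × Bool) :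
    ekLetterJet g V 2 a 0 =
      if a.2 then (g a.1 : Matrix (Fin N) (Fin N) ℂ) * (V a.1 * V a.1)
      else V a.1 * V a.1 * (g a.1 : Matrix (Fin N) (Fin N) ℂ)ᴴ := by
  unfold ekLetterJet
  by_cases h : a.2 = true
  · simp [h, pow_two]
  · simp [h, pow_two]

end Jets

end Summit.QuantumFields.YangMills.Theorems.EguchiKawaiDirectionLadder
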